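import Summits.Ventures.LatticeQCDFlow.Scoring.SchwingerDysonOnePlaquette
import Literature.Analysis.FunctionSpaces.BesselIGeneratingFunction
import HarnessLib

/-!
# The one-plaquette expectations are Bessel ratios: `⟨cos θ⟩_β = I₁(β)/I₀(β)` (U(1)), `⟨cos α⟩_β = I₂(β)/I₁(β)` (SU(2))

HONEST FRAMING: exact (Metropolis-corrected) sampling algorithms for lattice gauge theory;
figures of merit are autocorrelation/cost numbers at stated couplings and volumes; no
continuum-physics claim.

Venture `LatticeQCDFlow` (cell pub-lqcd), sub-topic `Scoring`; FANOUT row 5 (`s0-sun-a`), GEN-7.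
NEW WORK of the cell (placement rule): the identification — left open in
`Scoring/OnePlaquetteEnclosures.lean` ("the identification of the series with modified Bessel
functions" NOT typed) — of the one-plaquette objects of `Scoring/SchwingerDysonOnePlaquette.lean`
with the tree's modified Bessel functions `Literature.Analysis.FunctionSpaces.besselI`
(`I_n(x) = π⁻¹ ∫₀^π e^{x cos θ} cos(nθ) dθ`, DLMF 10.32.3; power series and generating function in
`Literature/Analysis/FunctionSpaces/BesselIGeneratingFunction.lean`):

* U(1): `onePlaquetteZ β = 2π I₀(β)`, `∫₀^{2π} cos θ e^{β cos θ} dθ = 2π I₁(β)`, hence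
  **`onePlaquetteExpect_cos_eq_besselI_div`** `⟨cos θ⟩_β = I₁(β)/I₀(β)` for every real `β`;
* SU(2) (class angle `α`, reduced Haar weight `sin² α`, Wilson weight `e^{β cos α}`): one
  integration by parts each gives `β · Z₂(β) = π I₁(β)` (`d/dα[−sin α e^{β cos α}]
  = −cos α e^{β cos α} + β sin²α e^{β cos α}`) and `β · N₂(β) = π I₂(β)`
  (`d/dα[−sin α cos α e^{β cos α}] = −cos 2α e^{β cos α} + β cos α sin²α e^{β cos α}`), hence
  **`onePlaquetteExpectSU2_cos_eq_besselI_div`** `⟨cos α⟩_β = I₂(β)/I₁(β)` for every real `β`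
  (at `β = 0` both sides are `0`: the left by `∫₀^π cos α sin²α dα = 0`, the right because
  `I₁(0) = 0` and `x / 0 = 0`).

These are the infinite-volume 2-d Wilson plaquettes of U(1) and SU(2) in the form the cell's
oracles print them (X01 / X02, `reference_table v0.3`: `I₁/I₀`, `I₂/I₁`); the kernel-checked
twelve-digit enclosures of the left-hand sides are `Scoring/OnePlaquetteEnclosures.lean`, and the
finite-torus formula whose `V → ∞` limit they are is `Scoring/U1TorusCharacterFormula.lean`.
NOT here: SU(3) (two-angle class integral; `Scoring/OnePlaquetteSU3*.lean`), the limit `V → ∞`.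
-/

noncomputable section

open Real MeasureTheory intervalIntegral Literature.Analysis.FunctionSpaces

namespace Summit.Ventures.LatticeQCDFlow.Scoring

/-! ### U(1) -/

/-- `Z(β) = ∫₀^{2π} e^{β cos θ} dθ = 2π I₀(β)`. -/
theorem onePlaquetteZ_eq_besselI (β : ℝ) : onePlaquetteZ β = 2 * π * besselI 0 β := by
  rw [onePlaquetteZ, ← integral_exp_mul_cos_mul_cos 0 β]
  refine intervalIntegral.integral_congr fun θ _ => ?_
  simp

/-- `∫₀^{2π} cos θ e^{β cos θ} dθ = 2π I₁(β)`. -/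
theorem integral_cos_mul_exp_mul_cos (β : ℝ) :
    ∫ θ in (0 : ℝ)..(2 * π), Real.cos θ * Real.exp (β * Real.cos θ) = 2 * π * besselI 1 β := by
  rw [← integral_exp_mul_cos_mul_cos 1 β]
  refine intervalIntegral.integral_congr fun θ _ => ?_
  simp [mul_comm]

/-- **The U(1) one-plaquette expectation is a Bessel ratio**: `⟨cos θ⟩_β = I₁(β)/I₀(β)` for every
real `β` (the infinite-volume 2-d U(1) Wilson plaquette, X01 / `reference_table`). -/
theorem onePlaquetteExpect_cos_eq_besselI_div (β : ℝ) :
    onePlaquetteExpect β Real.cos = besselI 1 β / besselI 0 β := by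
  rw [onePlaquetteExpect, integral_cos_mul_exp_mul_cos, onePlaquetteZ_eq_besselI,
    mul_div_mul_left _ _ (by positivity : (2 * π : ℝ) ≠ 0)]

/-! ### SU(2) -/

/-- `∫₀^π e^{β cos α} cos(nα) dα = π I_n(β)` (the defining integral of the tree's `besselI`). -/
theorem integral_exp_mul_cos_mul_cos_nat_eq_pi_mul (n : ℕ) (β : ℝ) :
    ∫ α in (0 : ℝ)..π, Real.exp (β * Real.cos α) * Real.cos (n * α) = π * besselI n β := by
  rw [besselI, ← mul_assoc, mul_inv_cancel₀ Real.pi_ne_zero, one_mul]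

/-- **`β · Z₂(β) = π I₁(β)`**: `∫₀^π (cos α − β sin² α) e^{β cos α} dα = 0` is one integration by
parts (`d/dα[sin α e^{β cos α}]`, `Scoring/SchwingerDysonOnePlaquette.lean`), and
`∫₀^π cos α e^{β cos α} dα = π I₁(β)`. -/
theorem beta_mul_onePlaquetteZSU2 (β : ℝ) : β * onePlaquetteZSU2 β = π * besselI 1 β := by
  have h0 : ∫ α in (0 : ℝ)..π, sdResidualDensity β α = 0 := by
    rw [integral_eq_sub_of_hasDerivAt (fun θ _ => hasDerivAt_sin_mul_exp_cos β θ)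
      ((continuous_sdResidualDensity β).intervalIntegrable _ _)]
    simp [Real.sin_pi]
  have hc1 : Continuous fun α => Real.exp (β * Real.cos α) * Real.cos ((1 : ℕ) * α) := by fun_prop
  have hc2 : Continuous fun α => β * (Real.sin α ^ 2 * Real.exp (β * Real.cos α)) := by fun_prop
  have hsplit : (fun α => sdResidualDensity β α) = fun α =>
      Real.exp (β * Real.cos α) * Real.cos ((1 : ℕ) * α) -
        β * (Real.sin α ^ 2 * Real.exp (β * Real.cos α)) := by
    funext α
    rw [sdResidualDensity, Nat.cast_one, one_mul]
    ring
  rw [hsplit, intervalIntegral.integral_sub (hc1.intervalIntegrable _ _) (hc2.intervalIntegrable _ _),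
    integral_exp_mul_cos_mul_cos_nat_eq_pi_mul, intervalIntegral.integral_const_mul] at h0
  rw [onePlaquetteZSU2]
  linarith

/-- `d/dα [sin α cos α · e^{β cos α}] = (cos² α − sin² α) e^{β cos α} − β cos α sin² α e^{β cos α}`. -/
theorem hasDerivAt_sin_mul_cos_mul_exp_cos (β α : ℝ) :
    HasDerivAt (fun x => Real.sin x * Real.cos x * Real.exp (β * Real.cos x))
      ((Real.cos α ^ 2 - Real.sin α ^ 2) * Real.exp (β * Real.cos α) -
        β * (Real.cos α * (Real.sin α ^ 2 * Real.exp (β * Real.cos α)))) α := by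
  have h1 : HasDerivAt (fun x => β * Real.cos x) (β * (-Real.sin α)) α :=
    (Real.hasDerivAt_cos α).const_mul β
  have h2 : HasDerivAt (fun x => Real.exp (β * Real.cos x))
      (Real.exp (β * Real.cos α) * (β * (-Real.sin α))) α := h1.exp
  have h : HasDerivAt (fun x => Real.sin x * Real.cos x * Real.exp (β * Real.cos x))
      ((Real.cos α * Real.cos α + Real.sin α * -Real.sin α) * Real.exp (β * Real.cos α) +
        Real.sin α * Real.cos α * (Real.exp (β * Real.cos α) * (β * -Real.sin α))) α :=
    ((Real.hasDerivAt_sin α).mul (Real.hasDerivAt_cos α)).mul h2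
  exact h.congr_deriv (by ring)

/-- `cos² α − sin² α = cos 2α`, so `∫₀^π (cos² α − sin² α) e^{β cos α} dα = π I₂(β)`. -/
theorem integral_cos_sq_sub_sin_sq_mul_exp (β : ℝ) :
    ∫ α in (0 : ℝ)..π, (Real.cos α ^ 2 - Real.sin α ^ 2) * Real.exp (β * Real.cos α) =
      π * besselI 2 β := by
  rw [← integral_exp_mul_cos_mul_cos_nat_eq_pi_mul 2 β]
  refine intervalIntegral.integral_congr fun α _ => ?_
  rw [show ((2 : ℕ) : ℝ) * α = 2 * α by push_cast; ring, Real.cos_two_mul, Real.sin_sq]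
  ring

/-- **`β · N₂(β) = π I₂(β)`**: `β ∫₀^π cos α sin² α e^{β cos α} dα = ∫₀^π cos 2α e^{β cos α} dα`
(one integration by parts; the boundary term `[sin α cos α e^{β cos α}]₀^π` vanishes). -/
theorem beta_mul_integral_cos_sin_sq_exp (β : ℝ) :
    β * ∫ α in (0 : ℝ)..π, Real.cos α * (Real.sin α ^ 2 * Real.exp (β * Real.cos α)) =
      π * besselI 2 β := by
  have hc1 : Continuous fun α => (Real.cos α ^ 2 - Real.sin α ^ 2) * Real.exp (β * Real.cos α) := by
    fun_prop
  have hc2 : Continuous fun α => β * (Real.cos α * (Real.sin α ^ 2 * Real.exp (β * Real.cos α))) := by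
    fun_prop
  have hparts := integral_eq_sub_of_hasDerivAt (a := 0) (b := π)
    (fun α _ => hasDerivAt_sin_mul_cos_mul_exp_cos β α) ((hc1.sub hc2).intervalIntegrable _ _)
  rw [intervalIntegral.integral_sub (hc1.intervalIntegrable _ _) (hc2.intervalIntegrable _ _),
    integral_cos_sq_sub_sin_sq_mul_exp, intervalIntegral.integral_const_mul] at hparts
  simp only [Real.sin_pi, Real.sin_zero, zero_mul, sub_self] at hparts
  linarith

/-- `I₁(0) = 0` (from `β Z₂(β) = π I₁(β)` at `β = 0`). -/
theorem besselI_one_zero : besselI 1 0 = 0 := by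
  have h := beta_mul_onePlaquetteZSU2 0
  rw [zero_mul] at h
  exact (mul_eq_zero.mp h.symm).resolve_left Real.pi_ne_zero

/-- **The SU(2) one-plaquette expectation is a Bessel ratio**: `⟨cos α⟩_β = I₂(β)/I₁(β)` for every
real `β` (the infinite-volume 2-d SU(2) Wilson plaquette `⟨½ tr U_p⟩`, X02 / `reference_table`;
at `β = 0` both sides vanish, the right one by `I₁(0) = 0` and `x / 0 = 0`). -/
theorem onePlaquetteExpectSU2_cos_eq_besselI_div (β : ℝ) :
    onePlaquetteExpectSU2 β Real.cos = besselI 2 β / besselI 1 β := by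
  rcases eq_or_ne β 0 with rfl | hβ
  · rw [besselI_one_zero, div_zero, onePlaquetteExpectSU2]
    simp only [zero_mul, Real.exp_zero, mul_one]
    rw [integral_cos_mul_sin_sq_zero_pi, zero_div]
  · rw [onePlaquetteExpectSU2, ← mul_div_mul_left _ (onePlaquetteZSU2 β) hβ,
      beta_mul_integral_cos_sin_sq_exp, beta_mul_onePlaquetteZSU2,
      mul_div_mul_left _ _ Real.pi_ne_zero]

end Summit.Ventures.LatticeQCDFlow.Scoring
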